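import Summits.HodgeConjecture.HodgeConjecture.Theorems.VHCAbelianSchemesRoadServedFibreCM
import HarnessLib

/-!
# Road b02 (`VHCAbelianSchemesRoad`) × the André column — SERVED CLASSES = ALGEBRAIC CLASSES: variational Hodge on COMPACT abelian
# pencils from the door and the pinned designs; `HC_AV` from `HC_CM`, Lemme 6.3.1, the door and carriers for ALGEBRAIC classes on CM
# abelian varieties only (cell-free, residual-free)

research route, not a corollary; conditional on HC_CM plus one named minimal statement.

PART AA (gen 58) proved the cell-free edge «door ∧ anchored carrier ∧ served fibre ⟹ `W` algebraic on every fibre» and instantiated it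
at CM anchors with ALL classes of Hodge type `(p,p)` served (`VHCAbelianSchemesRoadServedFibreCM`): `HC_AV ⟸ #21 ∧ door ∧ «carriers for
every rational `(p,p)` class on every CM abelian `n`-fold»`, a carrier statement that STRENGTHENS `HC_CM`. This file serves ALGEBRAIC classes
instead — the carrier demand then contains no Hodge-theoretic unknown (it asks, for a KNOWN algebraic class `w` on a polarised abelian
variety `(X, θ)`, an `𝒪`-admissible datum with `κ_p = a·w + c_p·θᵖ`, `a ≠ 0`, sides on the `θ`-ray: Bloch's semiregular-representative
problem `a·z₀ + b·l₀ᵖ` for algebraic cycles) — and records what it buys: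

* §1 The full anchor data «every polarised abelian `n`-fold / every algebraic class» on COMPACT pencils: a compact pencil of abelian varieties
  with a fibre where `W` is algebraic is served there (`hasServedFibre_compactPencil_abelianPolarised_algebraic`, the relative hyperplane class
  polarising every fibre); hence **`invariantCyclesHoldFor_compactPencil_of_pinnedDesignAt`**: the door for `𝒪` ∧ `PinnedDesignAt 𝒪 n p` for
  the mid-range `2 ≤ p ≤ n − 2` ⟹ Grothendieck's transport of algebraicity `Abdulali1994.InvariantCyclesHoldFor f n` on EVERY compact pencil
  `f` of abelian varieties of relative dimension `n` (off the mid-range every fibre is Lefschetz, PART W) — André's Remarque-2 input (the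
  cell's node `Ring2.Deform.CompactAbelianPencilVHC`) DISCHARGED BY PER-VARIETY DESIGNS FOR ALGEBRAIC CLASSES, with no curve residual
  (everything is projective) and no cell of K-SR♭∃.
* §2 With the tree's André reduction (`Andre1996.hodgeConjecture_abelian_of_andre1996_pencils`, Lemmes 6.3.1–6.3.3 as REFEREED named facts by
  name): **`forall_hodgeConjectureFor_of_andre1996_of_door_of_pinnedDesignAt`** — #21 ∧ #22 ∧ door ∧ «pinned designs at every `(n, p)`,
  `2 ≤ p ≤ n − 2`» ⟹ `∀ A, HodgeConjectureFor A.dim A.X`; `HC_CM` is a CONCLUSION on this row (`cmHodgeHypothesisAt_of_anchoredPencils_…`,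
  from #22 ∧ door ∧ designs, no #21), never a hypothesis.
* §3 The `HC_CM`-LOAD-BEARING row with the SMALLEST carrier statement of the column: CM anchors, ALGEBRAIC served classes. An André pencil
  (Lemme 6.3.1) is served at its CM fibre as soon as `W` is algebraic there (`hasServedFibre_compactPencil_of_cmFibre_of_mem_algebraicClasses`),
  which `HC_CM` AT DIMENSION `2g` provides; so **`hodgeConjectureFor_of_cmAnchoredPencil_of_cmHodge_of_cmAlgebraicCarrierAt`**: for ONE
  abelian `g`-fold `A`, Lemme 6.3.1 ∧ door ∧ `HC_CM`(dim `2g`) ∧ «`𝒪`-carriers for rational ALGEBRAIC classes of codimension `2 ≤ p ≤ g − 2`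
  on polarised CM abelian `2g`-folds» ⟹ `HodgeConjectureFor g A.X`; rows `hcAtDim_of_…` (`HCAtDim g`), the FOURFOLD row
  `hcAtDim_four_of_…` (ONE cell: carriers for algebraic `(2,2)`-classes on CM abelian 8-folds, next to `HC_CM` at dimension 8 — the first
  instance of the column, a find-the-sheaf problem for known cycles), `HC_AV` from `HC_CM` ∧ all `(2g, p)` (`forall_…`), and `HC_AV` from
  `HC_CM` ∧ `HCUpToDim 5` (Markman 2025 Cor. 1.3, UNREFEREED) ∧ the cells `g ≥ 6` (`hc_av_of_HC_CM_of_hcUpToDim_five_of_…`).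
* §4 The carrier statements compared at one `(n, p)` (anchored-carrier level, door-generic): CM-algebraic ⟸ pinned design (restriction);
  CM-algebraic ⟸ CM-Hodge-type (PART AA-f's data; algebraic classes are `(p,p)`); CM-Hodge-type ⟸ `HC_CM`(dim `n`) ∧ CM-algebraic. So
  next to `HC_CM` the two CM carrier statements are EQUIVALENT and the algebraic one is the honest `B_min` of the column.

HONEST: every carrier / design statement here is OPEN and NOT implied by the Hodge conjecture (a semiregular representative is more than
algebraicity: Bloch 1972 asks it as a question; Buchweitz–Flenner 2003 construct the map, not the representatives); they are HYPOTHESES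
wherever used, as are the door (`LocalVariationalHodgeFor 𝒪` / `TwistedPerfectDoorVHC`), Lemme 6.3.1 (`andre1996_cmAnchoredPencil`) and
Lemmes 6.3.2–6.3.3 (`andre1996_cmHodgeClasses_algebraicallyAnchoredPencils`) — REFEREED named facts entering BY NAME — and `HC_CM`
(an explicit ARGUMENT in §3–§4, a CONCLUSION in §2). Nothing here says any carrier, design, door, `HC_CM`, `HC_AV` or HC holds.
References: [cite: Andre1996Motifs, §6.3 Lemme 6.3.1–6.3.3 and Remarque 2 (pp. 31–33)] [cite: Bloch1972Semiregularity, Remark (7.5)]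
[cite: BuchweitzFlenner2003, §5 Thm. 5.1] [cite: Abdulali1994FamiliesAV, (1.1) and Lemma 6.2] [cite: CharlesSchnell2014Notes, Prop. 11.3.11 (proof) and Cor. 11.3.6]
[cite: Milne1999, §7 p. 72] [cite: Markman2025SurveySecant, Cor. 1.3] [cite: VoisinHodgeI2002, Thm. 6.25, Thm. 7.10 and §7.1.2].
-/

noncomputable section

open CategoryTheory CategoryTheory.Limits AlgebraicGeometry Topology

namespace Summit.HodgeConjecture.HodgeConjecture.Ring2.SemiregularRepresentatives

-- the cell's namespace repeats the summit name (`Summit.HodgeConjecture.HodgeConjecture…`), as in every `Ring2*` file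
set_option linter.dupNamespace false

open Literature.AlgebraicGeometry Literature.AlgebraicGeometry.Motives
open Literature.AlgebraicGeometry.HodgeTheory
open Literature.AlgebraicTopology.SingularHomology
open Literature.Barriers.HodgeConjecture (divisorClassesSpan)
open Literature.AlgebraicGeometry.Abdulali1994 (InvariantCyclesHoldFor)
open Literature.AlgebraicGeometry.Andre1996 (andre1996_cmAnchoredPencil andre1996_cmHodgeClasses_algebraicallyAnchoredPencils
  IsCMAnchoredPencilFor compactPencil_dim_eq_of_iso compactPencil_irreducibleSpace_base compactPencil_smooth_base
  compactPencil_exists_abelianVariety_fiber_dim hodgeConjecture_abelian_of_andre1996_pencils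
  cmHodgeHypothesisAt_of_algebraicallyAnchoredPencils)
open Literature.AlgebraicGeometry.Milne1999 (IsOfCMType CMHodgeHypothesisAt)
open Summit.HodgeConjecture.HodgeConjecture.Ring2.Binders
open Summit.HodgeConjecture.HodgeConjecture.Ring2.ClassTargets
open Summit.Ventures.HSemireg (ObjClass LocalVariationalHodgeFor)

variable {𝒪 : ObjClass} {n p : ℕ}
variable {𝒳 S : SchemeOver ℂ} {f : 𝒳 ⟶ S}

/-! ## §1 The full anchor data on compact pencils: transport of algebraicity from the pinned designs -/

/-- **A compact pencil of abelian varieties with a fibre where `W` is algebraic is SERVED there** for the full anchor data «`X ≅` an abelian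
`n`-fold, `θ` a polarisation class» / «algebraic classes»: the relative hyperplane class of the projective total space polarises every
fibre (ring2-b02's `exists_forall_isPolarizationClass_map_fiberι`). The compact twin of `hasServedFibre_abelianPolarised_algebraic`
(affine bases). [cite: VoisinHodgeI2002, Thm. 6.25, Thm. 7.10 and §7.1.2] [cite: Andre1996Motifs, §6.3 footnote (2) (p. 31)] -/
theorem hasServedFibre_compactPencil_abelianPolarised_algebraic (hf : IsCompactAbelianPencil f n) (W : complexBetti 𝒳 (2 * p))
    (s₀ : ComplexPoints S) (halg : complexBetti.map (fiberι f s₀) (2 * p) W ∈ algebraicClasses (fiberOver f s₀) p) :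
    HasServedFibre n p (fun X θ ↦ (∃ A : AbelianVariety ℂ, A.dim = n ∧ Nonempty (A.X ≅ X)) ∧ IsPolarizationClass n X θ)
      (fun X _ ↦ (algebraicClasses X p : Set (complexBetti X (2 * p)))) f W := by
  haveI : IsSeparated S.hom :=
    (IsQuasiProjectiveOver.of_isProjectiveOver hf.isSmoothProjective_base.isProjectiveOver).isSeparated
  obtain ⟨Θ, hΘ⟩ := exists_forall_isPolarizationClass_map_fiberι f hf.isSmoothProjectiveFamily
    (IsQuasiProjectiveOver.of_isProjectiveOver hf.isSmoothProjective_total.isProjectiveOver)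
  exact ⟨s₀, Θ, fun s ↦ (hΘ s).isRationalClass,
    fun s ↦ isOfHodgeType_of_mem_algebraicClasses_of_isSmoothProjective (hf.isSmoothProjectiveFamily.isSmoothProjective s) 1
      (hΘ s).mem_algebraicClasses,
    ⟨compactPencil_exists_abelianVariety_fiber_dim hf s₀, hΘ s₀⟩, halg⟩

/-- **Door ∧ pinned design at `(n, p)` ⟹ on every compact pencil of abelian varieties of relative dimension `n`, a fibrewise rational
`(p,p)` class algebraic on ONE fibre is algebraic on EVERY fibre** (PART AA-f §1 fed by §1's served fibre and PART AA-b's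
`anchoredCarrierAt_abelianPolarised_algebraic_iff`). [cite: BuchweitzFlenner2003, §5 Thm. 5.1] [cite: Bloch1972Semiregularity, Remark (7.5)]
[cite: CharlesSchnell2014Notes, Prop. 11.3.11 (proof)] -/
theorem mem_algebraicClasses_compactPencil_of_pinnedDesignAt (hT : LocalVariationalHodgeFor 𝒪) (hpin : PinnedDesignAt 𝒪 n p)
    (hf : IsCompactAbelianPencil f n) (W : complexBetti 𝒳 (2 * p))
    (hW : ∀ s : ComplexPoints S, IsRationalClass (complexBetti.map (fiberι f s) (2 * p) W) ∧
      IsOfHodgeType n (fiberOver f s) (2 * p) p p (complexBetti.map (fiberι f s) (2 * p) W))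
    {s₀ : ComplexPoints S} (halg : complexBetti.map (fiberι f s₀) (2 * p) W ∈ algebraicClasses (fiberOver f s₀) p)
    (s : ComplexPoints S) : complexBetti.map (fiberι f s) (2 * p) W ∈ algebraicClasses (fiberOver f s) p :=
  mem_algebraicClasses_compactPencil_of_anchoredCarrierAt_of_hasServedFibre hT (anchoredCarrierAt_abelianPolarised_algebraic_iff.2 hpin)
    hf W hW (hasServedFibre_compactPencil_abelianPolarised_algebraic hf W s₀ halg) s

/-- **GROTHENDIECK'S TRANSPORT OF ALGEBRAICITY ON COMPACT ABELIAN PENCILS FROM THE DOOR AND THE PINNED DESIGNS** (kernel): if `𝒪` satisfies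
its local variational Hodge statement and `PinnedDesignAt 𝒪 n p` holds for the mid-range codimensions `2 ≤ p ≤ n − 2`, then
`InvariantCyclesHoldFor f n` for every compact pencil `f` of abelian varieties of relative dimension `n`. Off the mid-range every fibre is
Lefschetz (`mem_algebraicClasses_and_divisorClassesSpan_of_offMidRange`: Lefschetz `(1,1)` / hard Lefschetz); in it, the mid-range lemma
above. No curve residual, no cell of K-SR♭∃. [cite: Abdulali1994FamiliesAV, (1.1) (p. 1122)] [cite: Andre1996Motifs, §6.3 Remarque 2 (p. 33)]
[cite: BuchweitzFlenner2003, §5 Thm. 5.1] [cite: VoisinHodgeI2002, Thm. 6.25 and Thm. 7.10] -/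
theorem invariantCyclesHoldFor_compactPencil_of_pinnedDesignAt (hT : LocalVariationalHodgeFor 𝒪)
    (hpin : ∀ p : ℕ, 2 ≤ p → p + 2 ≤ n → PinnedDesignAt 𝒪 n p) (hf : IsCompactAbelianPencil f n) :
    InvariantCyclesHoldFor f n := by
  intro p W hW h₀ s
  obtain ⟨s₀, h₀⟩ := h₀
  by_cases hoff : p ≤ 1 ∨ n ≤ p + 1
  · exact (mem_algebraicClasses_and_divisorClassesSpan_of_offMidRange (hf.isSmoothProjectiveFamily.isSmoothProjective s) hoff _
      (hW s).1 (hW s).2).1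
  · exact mem_algebraicClasses_compactPencil_of_pinnedDesignAt hT (hpin p (by omega) (by omega)) hf W hW h₀ s

/-- **… for every relative dimension at once**: door ∧ «pinned designs at every `(n, p)`, `2 ≤ p ≤ n − 2`» ⟹ transport of algebraicity on
EVERY compact pencil of abelian varieties — the body of the cell's node `Ring2.Deform.CompactAbelianPencilVHC` and the hypothesis `hV` of
the tree's André reduction. [cite: Andre1996Motifs, §6.3 Remarque 2 (p. 33)] [cite: Milne2020HodgeClassesAV, Rem. 3]
[cite: Abdulali1994FamiliesAV, (1.1) (p. 1122)] -/
theorem forall_invariantCyclesHoldFor_compactPencil_of_pinnedDesignAt (hT : LocalVariationalHodgeFor 𝒪)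
    (hpin : ∀ n p : ℕ, 2 ≤ p → p + 2 ≤ n → PinnedDesignAt 𝒪 n p) :
    ∀ ⦃d : ℕ⦄ ⦃𝒳 S : SchemeOver ℂ⦄ (f : 𝒳 ⟶ S), IsCompactAbelianPencil f d → InvariantCyclesHoldFor f d :=
  fun d _ _ _ hf ↦ invariantCyclesHoldFor_compactPencil_of_pinnedDesignAt hT (hpin d) hf

/-- **Twisted-door form, per Chern character theory `C`** (`TwistedPerfectDoorVHC C Adm` in place of `LocalVariationalHodgeFor`).
[cite: Pridham2024Semiregularity, Cor. 2.25 and Rem. 2.27] [cite: Markman2025SecantWeil, §7.3] [cite: Abdulali1994FamiliesAV, (1.1)] -/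
theorem forall_invariantCyclesHoldFor_compactPencil_of_twistedPerfectDoorVHC_of_pinnedDesignAt {C : ChernCharacterBetti}
    {Adm : PerfectAdmissibility} (hT : TwistedPerfectDoorVHC C Adm)
    (hpin : ∀ n p : ℕ, 2 ≤ p → p + 2 ≤ n → PinnedDesignAt (twistedReflexiveClass C Adm) n p) :
    ∀ ⦃d : ℕ⦄ ⦃𝒳 S : SchemeOver ℂ⦄ (f : 𝒳 ⟶ S), IsCompactAbelianPencil f d → InvariantCyclesHoldFor f d :=
  forall_invariantCyclesHoldFor_compactPencil_of_pinnedDesignAt ((twistedPerfectDoorVHC_iff_localVariationalHodgeFor C Adm).1 hT) hpin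

/-! ## §2 André's reduction fed by the designs: `HC_CM` as a conclusion, `HC_AV` with `HC_CM` idle -/

/-- **`HC_CM` AS A CONCLUSION: Lemmes 6.3.2–6.3.3 ∧ door ∧ pinned designs ⟹ `CMHodgeHypothesisAt B` for every complex abelian variety `B`**
(the tree's `cmHodgeHypothesisAt_of_algebraicallyAnchoredPencils` with its compact-pencil input discharged by §1; Lemme 6.3.1 not used).
[cite: Andre1996Motifs, Lemme 6.3.2 (p. 32), Lemme 6.3.3 (p. 33) and §6.3 b), c)] [cite: Milne1999, §7 p. 72] [cite: BuchweitzFlenner2003, §5 Thm. 5.1] -/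
theorem cmHodgeHypothesisAt_of_anchoredPencils_of_door_of_pinnedDesignAt (h₂₂ : andre1996_cmHodgeClasses_algebraicallyAnchoredPencils)
    (hT : LocalVariationalHodgeFor 𝒪) (hpin : ∀ n p : ℕ, 2 ≤ p → p + 2 ≤ n → PinnedDesignAt 𝒪 n p) (B : AbelianVariety ℂ) :
    CMHodgeHypothesisAt B :=
  cmHodgeHypothesisAt_of_algebraicallyAnchoredPencils h₂₂ (forall_invariantCyclesHoldFor_compactPencil_of_pinnedDesignAt hT hpin) B

/-- **`HC_AV` FROM LEMMES 6.3.1–6.3.3, THE DOOR AND THE PINNED DESIGNS FOR ALGEBRAIC CLASSES** (kernel; `HC_CM` idle — it is an intermediate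
conclusion; no cell of K-SR♭∃, no curve residual): the tree's `hodgeConjecture_abelian_of_andre1996_pencils` (André's §6.3 with «motivé»
replaced by «algébrique», Remarque 2) with its one remaining input — transport of algebraicity on compact abelian pencils — supplied by §1.
[cite: Andre1996Motifs, §6.3 Lemmes 6.3.1–6.3.3 and Remarque 2 (pp. 31–33)] [cite: Milne2020HodgeClassesAV, Rem. 2–3]
[cite: Bloch1972Semiregularity, Remark (7.5)] [cite: BuchweitzFlenner2003, §5 Thm. 5.1] -/
theorem forall_hodgeConjectureFor_of_andre1996_of_door_of_pinnedDesignAt (h₂₁ : andre1996_cmAnchoredPencil)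
    (h₂₂ : andre1996_cmHodgeClasses_algebraicallyAnchoredPencils) (hT : LocalVariationalHodgeFor 𝒪)
    (hpin : ∀ n p : ℕ, 2 ≤ p → p + 2 ≤ n → PinnedDesignAt 𝒪 n p) :
    ∀ A : AbelianVariety ℂ, HodgeConjectureFor A.dim A.X :=
  fun A ↦ hodgeConjecture_abelian_of_andre1996_pencils h₂₁ h₂₂
    (forall_invariantCyclesHoldFor_compactPencil_of_pinnedDesignAt hT hpin) A AbelianVariety.isSmoothProjective_holds

/-- **Twisted-door form, per `C`**: #21 ∧ #22 ∧ `TwistedPerfectDoorVHC C Adm` ∧ twisted pinned designs ⟹ `HC_AV`.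
[cite: Andre1996Motifs, §6.3 (pp. 31–33)] [cite: Pridham2024Semiregularity, Cor. 2.25 and Rem. 2.27] [cite: Markman2025SecantWeil, §7.3] -/
theorem forall_hodgeConjectureFor_of_andre1996_of_twistedPerfectDoorVHC_of_pinnedDesignAt {C : ChernCharacterBetti}
    {Adm : PerfectAdmissibility} (h₂₁ : andre1996_cmAnchoredPencil) (h₂₂ : andre1996_cmHodgeClasses_algebraicallyAnchoredPencils)
    (hT : TwistedPerfectDoorVHC C Adm) (hpin : ∀ n p : ℕ, 2 ≤ p → p + 2 ≤ n → PinnedDesignAt (twistedReflexiveClass C Adm) n p) :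
    ∀ A : AbelianVariety ℂ, HodgeConjectureFor A.dim A.X :=
  forall_hodgeConjectureFor_of_andre1996_of_door_of_pinnedDesignAt h₂₁ h₂₂ ((twistedPerfectDoorVHC_iff_localVariationalHodgeFor C Adm).1 hT)
    hpin

/-! ## §3 `HC_CM` load-bearing: CM anchors, ALGEBRAIC served classes — the smallest carrier statement of the column -/

/-- **An André pencil is SERVED at its CM fibre for ALGEBRAIC served classes as soon as `W` is algebraic there**: anchors «`X ≅` a CM abelian
`n`-fold, `θ` a polarisation class», served classes «algebraic»; the polarising global class is the relative hyperplane class, `sₐ := t`.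
[cite: Andre1996Motifs, Lemme 6.3.1 (ii) (p. 31)] [cite: VoisinHodgeI2002, Thm. 6.25, Thm. 7.10 and §7.1.2] [cite: Milne1999, §7 p. 72] -/
theorem hasServedFibre_compactPencil_of_cmFibre_of_mem_algebraicClasses (hf : IsCompactAbelianPencil f n) {t : ComplexPoints S}
    (A₀ : AbelianVariety ℂ) (e₀ : A₀.X ≅ fiberOver f t) (hA₀ : IsOfCMType A₀) (W : complexBetti 𝒳 (2 * p))
    (halg : complexBetti.map (fiberι f t) (2 * p) W ∈ algebraicClasses (fiberOver f t) p) :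
    HasServedFibre n p
      (fun X θ ↦ (∃ A₀ : AbelianVariety ℂ, A₀.dim = n ∧ IsOfCMType A₀ ∧ Nonempty (A₀.X ≅ X)) ∧ IsPolarizationClass n X θ)
      (fun X _ ↦ (algebraicClasses X p : Set (complexBetti X (2 * p)))) f W := by
  haveI : IsSeparated S.hom :=
    (IsQuasiProjectiveOver.of_isProjectiveOver hf.isSmoothProjective_base.isProjectiveOver).isSeparated
  obtain ⟨Θ, hΘ⟩ := exists_forall_isPolarizationClass_map_fiberι f hf.isSmoothProjectiveFamily
    (IsQuasiProjectiveOver.of_isProjectiveOver hf.isSmoothProjective_total.isProjectiveOver)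
  exact ⟨t, Θ, fun s ↦ (hΘ s).isRationalClass,
    fun s ↦ isOfHodgeType_of_mem_algebraicClasses_of_isSmoothProjective (hf.isSmoothProjectiveFamily.isSmoothProjective s) 1
      (hΘ s).mem_algebraicClasses,
    ⟨⟨A₀, compactPencil_dim_eq_of_iso hf e₀, hA₀, ⟨e₀⟩⟩, hΘ t⟩, halg⟩

/-- **HC FOR ONE ABELIAN `g`-FOLD `A` from Lemme 6.3.1, the door, `HC_CM` AT DIMENSION `2g` and CARRIERS FOR ALGEBRAIC CLASSES ON CM
ABELIAN `2g`-FOLDS in codimensions `2 ≤ p ≤ g − 2`** (cell-free, residual-free; the `HC_CM`-load-bearing twin of PART AA-f §3 with the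
smaller carrier statement). Codimensions `p ≤ 1`, `p ≥ g − 1` of `A` are Lefschetz (PART W); otherwise Lemme 6.3.1 gives a compact pencil of
relative dimension `2g` through `q·c` (`q ≠ 0`) with a CM fibre `𝒳_t ≅ A₀.X`, `dim A₀ = 2g`, where `HC_CM` makes `W|_t` algebraic (as in the
tree's `hodgeConjecture_abelian_of_cmAnchoredPencil`); the pencil is then served (above), the door and the carriers make `W` algebraic on
every fibre (PART AA-f §1), and `e₁`, `g'` bring it back to `A`. [cite: Andre1996Motifs, Lemme 6.3.1 (p. 31) and §6.3 a) (p. 33)]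
[cite: Abdulali1994FamiliesAV, Lemma 6.2 (p. 1131)] [cite: Bloch1972Semiregularity, Remark (7.5)] [cite: Milne1999, §7 p. 72] -/
theorem hodgeConjectureFor_of_cmAnchoredPencil_of_cmHodge_of_cmAlgebraicCarrierAt (h₂₁ : andre1996_cmAnchoredPencil)
    (hT : LocalVariationalHodgeFor 𝒪) (A : AbelianVariety ℂ)
    (hCM : ∀ A₀ : AbelianVariety ℂ, A₀.dim = 2 * A.dim → CMHodgeHypothesisAt A₀)
    (hcar : ∀ p : ℕ, 2 ≤ p → p + 2 ≤ A.dim → AnchoredCarrierAt 𝒪 (2 * A.dim) p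
      (fun X θ ↦ (∃ A₀ : AbelianVariety ℂ, A₀.dim = 2 * A.dim ∧ IsOfCMType A₀ ∧ Nonempty (A₀.X ≅ X)) ∧
        IsPolarizationClass (2 * A.dim) X θ)
      (fun X _ ↦ (algebraicClasses X p : Set (complexBetti X (2 * p))))) :
    HodgeConjectureFor A.dim A.X := by
  have hA : IsSmoothProjective A.dim A.X := AbelianVariety.isSmoothProjective_holds
  refine (hodgeConjectureFor_iff_of_isSmoothProjective nonempty_hodgeModel_holds hA).2 ?_
  intro p c hc hpp
  by_cases hoff : p ≤ 1 ∨ A.dim ≤ p + 1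
  · exact (mem_algebraicClasses_and_divisorClassesSpan_of_offMidRange hA hoff c hc hpp).1
  obtain ⟨𝒳, S, f, hf, s, t, W, A₁, A₀, e₁, g, q, hW, hq, hgc, ⟨e₀⟩, hA₀⟩ := h₂₁ A hA p c hc hpp
  -- the CM fibre `𝒳_t ≅ A₀.X`: `dim A₀ = 2 dim A`, and `HC_CM` there makes `W|_t` algebraic
  have hA₀sp : IsSmoothProjective A₀.dim A₀.X := AbelianVariety.isSmoothProjective_holds
  have hdim : A₀.dim = 2 * A.dim := compactPencil_dim_eq_of_iso hf e₀
  have h₀ : complexBetti.map (fiberι f t) (2 * p) W ∈ algebraicClasses (fiberOver f t) p := by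
    have hHC := (hCM A₀ hdim hA₀sp hA₀).2 p
    rw [hdim] at hHC
    exact (forall_hodgeClass_mem_algebraicClasses_iff_of_iso e₀ p).1 hHC _ (hW t).1 (hW t).2
  -- the pencil is served at `t` for algebraic served classes; the door and the CM-algebraic carriers make `W` algebraic everywhere
  have h₁ : complexBetti.map (fiberι f s) (2 * p) W ∈ algebraicClasses (fiberOver f s) p :=
    mem_algebraicClasses_compactPencil_of_anchoredCarrierAt_of_hasServedFibre hT (hcar p (by omega) (by omega)) hf W hW
      (hasServedFibre_compactPencil_of_cmFibre_of_mem_algebraicClasses hf A₀ e₀ hA₀ W h₀) s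
  -- pull back to `A` and divide by `q`
  have h₂ : complexBetti.map e₁.hom (2 * p) (complexBetti.map (fiberι f s) (2 * p) W) ∈ algebraicClasses A₁.X p :=
    (mem_algebraicClasses_map_iff_of_iso e₁).2 h₁
  have h₃ : (q : ℂ) • c ∈ algebraicClasses A.X p := by
    rw [← hgc]
    exact map_mem_algebraicClasses_of_abelianVariety hA A₁ g.hom.hom.hom h₂
  exact (Submodule.smul_mem_iff _ (Rat.cast_ne_zero.2 hq)).1 h₃

/-- **`HCAtDim g` — HC for complex abelian varieties of dimension `g` — from Lemme 6.3.1, the door, `HC_CM` at dimension `2g` and carriers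
for ALGEBRAIC classes of codimension `2 ≤ p ≤ g − 2` on polarised CM abelian `2g`-folds.** [cite: Andre1996Motifs, Lemme 6.3.1 (p. 31) and §6.3 a) (p. 33)]
[cite: Abdulali1994FamiliesAV, Lemma 6.2 (p. 1131)] [cite: Bloch1972Semiregularity, Remark (7.5)] -/
theorem hcAtDim_of_cmAnchoredPencil_of_cmHodge_of_cmAlgebraicCarrierAt (g : ℕ) (h₂₁ : andre1996_cmAnchoredPencil)
    (hT : LocalVariationalHodgeFor 𝒪) (hCM : ∀ A₀ : AbelianVariety ℂ, A₀.dim = 2 * g → CMHodgeHypothesisAt A₀)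
    (hcar : ∀ p : ℕ, 2 ≤ p → p + 2 ≤ g → AnchoredCarrierAt 𝒪 (2 * g) p
      (fun X θ ↦ (∃ A₀ : AbelianVariety ℂ, A₀.dim = 2 * g ∧ IsOfCMType A₀ ∧ Nonempty (A₀.X ≅ X)) ∧ IsPolarizationClass (2 * g) X θ)
      (fun X _ ↦ (algebraicClasses X p : Set (complexBetti X (2 * p))))) :
    HCAtDim g := by
  intro A hAg
  have hg : A.dim = g := hAg
  subst hg
  exact hodgeConjectureFor_of_cmAnchoredPencil_of_cmHodge_of_cmAlgebraicCarrierAt h₂₁ hT A hCM hcar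

/-- **THE FIRST INSTANCE OF THE COLUMN — ABELIAN FOURFOLDS FROM ONE CELL: `HCAtDim 4` from Lemme 6.3.1, the door, `HC_CM` at dimension
`8` and carriers for ALGEBRAIC `(2,2)`-CLASSES ON POLARISED CM ABELIAN 8-FOLDS** (`p = 2` is the only mid-range codimension of a fourfold).
As a find-the-object problem: for a CM abelian 8-fold `B`, a polarisation class `θ` and a rational ALGEBRAIC class `w ∈ H⁴(B(ℂ); ℂ)`, an
`𝒪`-admissible datum `(I ∋ 2, κ)` on `B` with `κ₂ = a·w + c₂·θ²`, `a ≠ 0`, `κ_q = c_q·θ^q` — a semiregular (twisted) representative,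
modulo the `θ`-ray, of a KNOWN algebraic 2-cycle. (Abelian fourfolds are also covered by `HCUpToDim 5` modulo Markman 2025, UNREFEREED;
this row is the fact-free one.) [cite: Andre1996Motifs, Lemme 6.3.1 (p. 31)] [cite: Bloch1972Semiregularity, Remark (7.5)]
[cite: MoonenZarhin1999, Thm. 0.1] -/
theorem hcAtDim_four_of_cmAnchoredPencil_of_cmHodge_eight_of_cmAlgebraicCarrierAt (h₂₁ : andre1996_cmAnchoredPencil)
    (hT : LocalVariationalHodgeFor 𝒪) (hCM : ∀ A₀ : AbelianVariety ℂ, A₀.dim = 8 → CMHodgeHypothesisAt A₀)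
    (hcar : AnchoredCarrierAt 𝒪 8 2
      (fun X θ ↦ (∃ A₀ : AbelianVariety ℂ, A₀.dim = 8 ∧ IsOfCMType A₀ ∧ Nonempty (A₀.X ≅ X)) ∧ IsPolarizationClass 8 X θ)
      (fun X _ ↦ (algebraicClasses X 2 : Set (complexBetti X (2 * 2))))) :
    HCAtDim 4 := by
  refine hcAtDim_of_cmAnchoredPencil_of_cmHodge_of_cmAlgebraicCarrierAt 4 h₂₁ hT (fun A₀ h₀ ↦ hCM A₀ h₀) fun p hp2 hp4 ↦ ?_
  obtain rfl : p = 2 := by omega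
  exact hcar

/-- **`HC_AV` (as `∀ A, HodgeConjectureFor A.dim A.X`) from Lemme 6.3.1, the door, `HC_CM` and CARRIERS FOR ALGEBRAIC CLASSES ON CM ABELIAN
VARIETIES** — on every `X ≅` a CM abelian `n`-fold, for every polarisation class `θ` and every rational ALGEBRAIC class `w` of codimension
`p` (`2 ≤ p`, `2p + 4 ≤ n`), an `𝒪`-datum with `κ_p = a·w + c_p·θᵖ`, `a ≠ 0`, sides on the `θ`-ray. The deliverable shape of the cell
«`HC_CM → B_min → HC_AV`» with `HC_CM` LOAD-BEARING and `B_min` the smallest carrier statement of the André column (known cycles on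
countably many varieties). [cite: Andre1996Motifs, Lemme 6.3.1 (p. 31) and §6.3 a) (p. 33)] [cite: Abdulali1994FamiliesAV, Lemma 6.2]
[cite: Bloch1972Semiregularity, Remark (7.5)] [cite: Milne1999, §7 p. 72] -/
theorem forall_hodgeConjectureFor_of_cmAnchoredPencil_of_cmHodge_of_cmAlgebraicCarrierAt (h₂₁ : andre1996_cmAnchoredPencil)
    (hT : LocalVariationalHodgeFor 𝒪) (hCM : ∀ A₀ : AbelianVariety ℂ, CMHodgeHypothesisAt A₀)
    (hcar : ∀ n p : ℕ, 2 ≤ p → 2 * p + 4 ≤ n → AnchoredCarrierAt 𝒪 n p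
      (fun X θ ↦ (∃ A₀ : AbelianVariety ℂ, A₀.dim = n ∧ IsOfCMType A₀ ∧ Nonempty (A₀.X ≅ X)) ∧ IsPolarizationClass n X θ)
      (fun X _ ↦ (algebraicClasses X p : Set (complexBetti X (2 * p))))) :
    ∀ A : AbelianVariety ℂ, HodgeConjectureFor A.dim A.X :=
  fun A ↦ hodgeConjectureFor_of_cmAnchoredPencil_of_cmHodge_of_cmAlgebraicCarrierAt h₂₁ hT A (fun A₀ _ ↦ hCM A₀)
    fun p hp2 hpA ↦ hcar (2 * A.dim) p hp2 (by omega)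

/-- **`HC_AV` on the cell's named decls from `HC_CM`, Lemme 6.3.1, the door, `HCUpToDim 5` (Markman 2025 Cor. 1.3, UNREFEREED) and carriers
for algebraic classes on polarised CM abelian `2g`-folds for `g ≥ 6` only** (codimensions `2 ≤ p ≤ g − 2`): modulo Markman's low
dimensions, the first cells the column needs are the CM abelian 12-folds in codimensions `2, 3, 4`. [cite: Andre1996Motifs, Lemme 6.3.1 (p. 31)]
[cite: Markman2025SurveySecant, Cor. 1.3] [cite: Bloch1972Semiregularity, Remark (7.5)] -/
theorem hc_av_of_HC_CM_of_hcUpToDim_five_of_cmAlgebraicCarrierAt_ge_six (h₂₁ : andre1996_cmAnchoredPencil)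
    (hT : LocalVariationalHodgeFor 𝒪) (hCM : Theses.RankFourFaces.CMAbelianHodge) (h₅ : HCUpToDim 5)
    (hcar : ∀ g p : ℕ, 6 ≤ g → 2 ≤ p → p + 2 ≤ g → AnchoredCarrierAt 𝒪 (2 * g) p
      (fun X θ ↦ (∃ A₀ : AbelianVariety ℂ, A₀.dim = 2 * g ∧ IsOfCMType A₀ ∧ Nonempty (A₀.X ≅ X)) ∧ IsPolarizationClass (2 * g) X θ)
      (fun X _ ↦ (algebraicClasses X p : Set (complexBetti X (2 * p))))) :
    Theses.PadicSemiregularLift.HodgeAbelianVarieties := by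
  refine hodgeAbelianVarieties_iff_forall_hcAtDim.2 fun g ↦ ?_
  rcases Nat.lt_or_ge g 6 with hg | hg
  · exact hcAtDim_of_hcUpToDim (hcUpToDim_mono (by omega) h₅)
  · exact hcAtDim_of_cmAnchoredPencil_of_cmHodge_of_cmAlgebraicCarrierAt g h₂₁ hT (fun A₀ _ ↦ hCM A₀) fun p hp2 hpg ↦
      hcar g p hg hp2 hpg

/-- **Twisted-door form of the `HC_CM`-load-bearing row, per `C`**: Lemme 6.3.1 ∧ `TwistedPerfectDoorVHC C Adm` ∧ `HC_CM` ∧ CM-algebraic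
twisted carriers ⟹ `HC_AV`. [cite: Andre1996Motifs, Lemme 6.3.1 (p. 31)] [cite: Pridham2024Semiregularity, Cor. 2.25 and Rem. 2.27]
[cite: Markman2025SecantWeil, §7.3 and Thm. 1.4.1] -/
theorem forall_hodgeConjectureFor_of_twistedPerfectDoorVHC_of_cmHodge_of_cmAlgebraicCarrierAt {C : ChernCharacterBetti}
    {Adm : PerfectAdmissibility} (h₂₁ : andre1996_cmAnchoredPencil) (hT : TwistedPerfectDoorVHC C Adm)
    (hCM : ∀ A₀ : AbelianVariety ℂ, CMHodgeHypothesisAt A₀)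
    (hcar : ∀ n p : ℕ, 2 ≤ p → 2 * p + 4 ≤ n → AnchoredCarrierAt (twistedReflexiveClass C Adm) n p
      (fun X θ ↦ (∃ A₀ : AbelianVariety ℂ, A₀.dim = n ∧ IsOfCMType A₀ ∧ Nonempty (A₀.X ≅ X)) ∧ IsPolarizationClass n X θ)
      (fun X _ ↦ (algebraicClasses X p : Set (complexBetti X (2 * p))))) :
    ∀ A : AbelianVariety ℂ, HodgeConjectureFor A.dim A.X :=
  forall_hodgeConjectureFor_of_cmAnchoredPencil_of_cmHodge_of_cmAlgebraicCarrierAt h₂₁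
    ((twistedPerfectDoorVHC_iff_localVariationalHodgeFor C Adm).1 hT) hCM hcar

/-! ## §4 The carrier statements at one `(n, p)`, compared -/

/-- **CM-ALGEBRAIC ⟸ PINNED DESIGN** (restriction of `PinnedDesignAt 𝒪 n p` — all polarised abelian `n`-folds, algebraic classes — to the CM
anchors). [cite: Bloch1972Semiregularity, Remark (7.5)] [cite: Milne1999, §7 p. 72] -/
theorem cmAlgebraicCarrierAt_of_pinnedDesignAt (h : PinnedDesignAt 𝒪 n p) :
    AnchoredCarrierAt 𝒪 n p
      (fun X θ ↦ (∃ A₀ : AbelianVariety ℂ, A₀.dim = n ∧ IsOfCMType A₀ ∧ Nonempty (A₀.X ≅ X)) ∧ IsPolarizationClass n X θ)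
      (fun X _ ↦ (algebraicClasses X p : Set (complexBetti X (2 * p)))) :=
  anchoredCarrierAt_of_pinnedDesignAt h (fun _ _ hXθ ↦ ⟨hXθ.1.imp fun _ h ↦ ⟨h.1, h.2.2⟩, hXθ.2⟩) fun _ _ _ _ hw ↦ hw

/-- **CM-ALGEBRAIC ⟸ CM-HODGE-TYPE** (PART AA-f's carrier statement — all rational `(p,p)` classes at CM anchors — gives the one for
algebraic classes: an algebraic class on the smooth projective anchor is of type `(p,p)`). [cite: Bloch1972Semiregularity, Remark (7.5)]
[cite: VoisinHodgeI2002, §11.3 Prop. 11.20] -/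
theorem cmAlgebraicCarrierAt_of_cmHodgeCarrierAt
    (h : AnchoredCarrierAt 𝒪 n p
      (fun X θ ↦ (∃ A₀ : AbelianVariety ℂ, A₀.dim = n ∧ IsOfCMType A₀ ∧ Nonempty (A₀.X ≅ X)) ∧ IsPolarizationClass n X θ)
      (fun X _ ↦ {w | IsOfHodgeType n X (2 * p) p p w})) :
    AnchoredCarrierAt 𝒪 n p
      (fun X θ ↦ (∃ A₀ : AbelianVariety ℂ, A₀.dim = n ∧ IsOfCMType A₀ ∧ Nonempty (A₀.X ≅ X)) ∧ IsPolarizationClass n X θ)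
      (fun X _ ↦ (algebraicClasses X p : Set (complexBetti X (2 * p)))) := by
  refine anchoredCarrierAt_anti (fun _ _ h' ↦ h') (fun X θ hXθ w hw ↦ ?_) h
  obtain ⟨⟨A₀, hd, -, ⟨e₀⟩⟩, -⟩ := hXθ
  have hX : IsSmoothProjective n X := hd ▸ (AbelianVariety.isSmoothProjective_holds (A := A₀)).of_iso e₀
  exact isOfHodgeType_of_mem_algebraicClasses_of_isSmoothProjective hX p hw

/-- **CM-HODGE-TYPE ⟸ `HC_CM` AT DIMENSION `n` ∧ CM-ALGEBRAIC**: at a CM anchor `X ≅ A₀.X` every rational `(p,p)` class is algebraic by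
`HC_CM` for `A₀` (moved along `e₀`), so the carrier statement for algebraic classes serves it. Hence next to `HC_CM` the two CM carrier
statements are equivalent (with `cmAlgebraicCarrierAt_of_cmHodgeCarrierAt`). [cite: Milne1999, §7 p. 72] [cite: Bloch1972Semiregularity, Remark (7.5)] -/
theorem cmHodgeCarrierAt_of_cmHodge_of_cmAlgebraicCarrierAt (hCM : ∀ A₀ : AbelianVariety ℂ, A₀.dim = n → CMHodgeHypothesisAt A₀)
    (h : AnchoredCarrierAt 𝒪 n p
      (fun X θ ↦ (∃ A₀ : AbelianVariety ℂ, A₀.dim = n ∧ IsOfCMType A₀ ∧ Nonempty (A₀.X ≅ X)) ∧ IsPolarizationClass n X θ)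
      (fun X _ ↦ (algebraicClasses X p : Set (complexBetti X (2 * p))))) :
    AnchoredCarrierAt 𝒪 n p
      (fun X θ ↦ (∃ A₀ : AbelianVariety ℂ, A₀.dim = n ∧ IsOfCMType A₀ ∧ Nonempty (A₀.X ≅ X)) ∧ IsPolarizationClass n X θ)
      (fun X _ ↦ {w | IsOfHodgeType n X (2 * p) p p w}) := by
  intro X θ hXθ w hw hwQ
  obtain ⟨⟨A₀, hd, hcm, ⟨e₀⟩⟩, hθ⟩ := hXθ
  refine h X θ ⟨⟨A₀, hd, hcm, ⟨e₀⟩⟩, hθ⟩ w ?_ hwQ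
  have hHC : HodgeConjectureFor A₀.dim A₀.X := hCM A₀ hd AbelianVariety.isSmoothProjective_holds hcm
  subst hd
  exact (mem_algebraicClasses_map_iff_of_iso e₀).1
    (hHC.2 p _ ((isRationalClass_map_iff_of_iso e₀).2 hwQ) ((isOfHodgeType_map_iff_of_iso e₀).2 hw))

/-- **… so next to `HC_CM` at dimension `n` the CM-Hodge-type and the CM-algebraic carrier statements at `(n, p)` are EQUIVALENT.**
[cite: Milne1999, §7 p. 72] [cite: Bloch1972Semiregularity, Remark (7.5)] -/
theorem cmHodgeCarrierAt_iff_cmAlgebraicCarrierAt_of_cmHodge (hCM : ∀ A₀ : AbelianVariety ℂ, A₀.dim = n → CMHodgeHypothesisAt A₀) :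
    AnchoredCarrierAt 𝒪 n p
        (fun X θ ↦ (∃ A₀ : AbelianVariety ℂ, A₀.dim = n ∧ IsOfCMType A₀ ∧ Nonempty (A₀.X ≅ X)) ∧ IsPolarizationClass n X θ)
        (fun X _ ↦ {w | IsOfHodgeType n X (2 * p) p p w}) ↔
      AnchoredCarrierAt 𝒪 n p
        (fun X θ ↦ (∃ A₀ : AbelianVariety ℂ, A₀.dim = n ∧ IsOfCMType A₀ ∧ Nonempty (A₀.X ≅ X)) ∧ IsPolarizationClass n X θ)
        (fun X _ ↦ (algebraicClasses X p : Set (complexBetti X (2 * p)))) :=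
  ⟨cmAlgebraicCarrierAt_of_cmHodgeCarrierAt, cmHodgeCarrierAt_of_cmHodge_of_cmAlgebraicCarrierAt hCM⟩

end Summit.HodgeConjecture.HodgeConjecture.Ring2.SemiregularRepresentatives

end
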